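import Mathlib
import Summits.AnomalousDissipation.AnomalousDissipation.Theses.DyadicWallCascade

/-!
# Sketch — first lemmas for the crux ideas on `DyadicWallCascade.HalfSpaceHierarchy`
(crux-ideate stmt-AnomalousDissipation-18627, ideator 1, round 1). Statements must elaborate;
proofs are not required (the trivial one is given).
-/

noncomputable section

namespace Summit.AnomalousDissipation.AnomalousDissipation.Cruxes.HalfSpaceHierarchy.Sketch

open scoped BigOperators
open MeasureTheory Set

/-- ambient space -/
abbrev E3 := EuclideanSpace ℝ (Fin 3)

/-- standard basis vector -/
def e (i : Fin 3) : E3 := EuclideanSpace.single i (1 : ℝ)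

/-- The body of `HalfSpaceHierarchy` as a predicate on `(V, Q, C, F)` (verbatim clauses). -/
def HSHBody (V : E3 → E3) (Q : E3 → ℝ) (C F : ℝ) : Prop :=
  let H : Set E3 := {X | 0 < X 2}
  let pt : ℝ × ℝ → E3 := fun q => !₂[q.1, q.2, (1 : ℝ)]
  ContDiffOn ℝ ((⊤ : ℕ∞) : WithTop ℕ∞) V H ∧ ContDiffOn ℝ ((⊤ : ℕ∞) : WithTop ℕ∞) Q H ∧
  (∀ X ∈ H, ‖V X‖ ≤ C ∧ |Q X| ≤ C) ∧
  (∀ X ∈ H, ∑ i : Fin 3, (fderiv ℝ V X (e i)) i = 0) ∧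
  (∀ X ∈ H, (fderiv ℝ V X) (V X) + gradient Q X = 0) ∧
  (∀ X ∈ H, V ((2 : ℝ) • X) = V X ∧ Q ((2 : ℝ) • X) = Q X) ∧
  (∀ X : E3, 1 ≤ X 2 → X 2 ≤ 2 →
      V (X + e 0) = V X ∧ V (X + e 1) = V X ∧ Q (X + e 0) = Q X ∧ Q (X + e 1) = Q X) ∧
  (∫ q in Set.Icc (0 : ℝ) 1 ×ˢ Set.Icc (0 : ℝ) 1, (V (pt q)) 2 = 0) ∧ F ≠ 0 ∧
  (∫ q in Set.Icc (0 : ℝ) 1 ×ˢ Set.Icc (0 : ℝ) 1, (V (pt q)) 2 * (‖V (pt q)‖ ^ 2 / 2 + Q (pt q)) = F)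

/-- Sanity: the crux is `∃ V Q C F, HSHBody V Q C F`. -/
theorem halfSpaceHierarchy_iff :
    Theses.DyadicWallCascade.HalfSpaceHierarchy ↔ ∃ V Q C F, HSHBody V Q C F := Iff.rfl

/-! ## Card `bernoulli-surface-topology` — first lemmas -/

/-- (a) At a stagnation point of a steady Euler flow the pressure gradient vanishes; hence
`H = |V|²/2 + Q = Q` there and (b) below. Proved. -/
theorem gradient_eq_zero_of_stagnation (V : E3 → E3) (Q : E3 → ℝ) (X : E3)
    (hEuler : (fderiv ℝ V X) (V X) + gradient Q X = 0) (hstag : V X = 0) :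
    gradient Q X = 0 := by
  simpa [hstag] using hEuler

/-- (b) A `C¹` curve of stagnation points lies in ONE Bernoulli level (`Q ∘ γ` is constant):
so "stagnation curves at the junctions" can never supply the Euler-characteristic budget that the
period-halving branching of Bernoulli surfaces needs on a.e. level (statement). -/
def StagnationCurveOneLevel : Prop :=
  ∀ (V : E3 → E3) (Q : E3 → ℝ) (U : Set E3), IsOpen U → ContDiffOn ℝ 1 Q U →
    (∀ X ∈ U, (fderiv ℝ V X) (V X) + gradient Q X = 0) →
    ∀ γ : ℝ → E3, Differentiable ℝ γ → (∀ t, γ t ∈ U) → (∀ t, V (γ t) = 0) →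
      ∀ s t : ℝ, Q (γ s) = Q (γ t)

/-- (c) **No columnar slab.** The first no-go the Euler-characteristic budget yields: a witness
of the crux body cannot be invariant under vertical translations on any open height slab
`a < z < b` (else Poincaré–Hopf on a.e. Bernoulli level surface + Sard on `Crit Q` + the factor-4
flux mismatch between dyadic levels force `V₃ ≡ 0` on the slab, hence `F = 0`). Statement of the
target; it kills every "vertical columnar channels + compact junctions" architecture. -/
def NoColumnarSlab : Prop :=
  ∀ (V : E3 → E3) (Q : E3 → ℝ) (C F : ℝ), HSHBody V Q C F →
    ∀ a b : ℝ, 0 < a → a < b →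
      (∀ X : E3, a < X 2 → X 2 < b → ∀ t : ℝ, a < X 2 + t → X 2 + t < b →
          V (X + t • e 2) = V X) → False

/-! ## Card `slender-swirl-fission` — first lemmas -/

/-- (d) The exact building block ("leg"): a columnar swirling vortex with arbitrary smooth
angular-velocity profile `σ(ρ)`, axial profile `w(ρ)` (`ρ = x² + y²`) and pressure `q(ρ)` with
`q' = σ²/2` is a smooth steady Euler flow on all of `ℝ³` (divergence free, momentum balance).
Compact support of `σ, w` in `ρ` embeds it in fluid at rest; rotating the frame tilts the leg.
Statement (routine `fderiv` computation; to be proved by whoever picks the line up). -/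
def ColumnarSwirlSteadyEuler : Prop :=
  ∀ (σ w q : ℝ → ℝ), ContDiff ℝ ((⊤ : ℕ∞) : WithTop ℕ∞) σ → ContDiff ℝ ((⊤ : ℕ∞) : WithTop ℕ∞) w →
    (∀ ρ : ℝ, HasDerivAt q (σ ρ ^ 2 / 2) ρ) →
    let V : E3 → E3 := fun X =>
      (σ (X 0 ^ 2 + X 1 ^ 2)) • (!₂[-(X 1), X 0, (0 : ℝ)] : E3) + (w (X 0 ^ 2 + X 1 ^ 2)) • e 2
    let Q : E3 → ℝ := fun X => q (X 0 ^ 2 + X 1 ^ 2)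
    (∀ X : E3, ∑ i : Fin 3, (fderiv ℝ V X (e i)) i = 0) ∧
    (∀ X : E3, (fderiv ℝ V X) (V X) + gradient Q X = 0)

/-- (e) The aspect ratio is free inside the crux as filed: a field that is `1/N`-periodic in
`x` and `y` on the band is `1`-periodic there (so tall cells / slender legs are admissible).
Proved for the `x`-direction (the `y`-direction is identical). -/
theorem periodic_one_of_periodic_inv_nat {α : Type*} (f : E3 → α) (N : ℕ) (hN : 0 < N)
    (S : Set E3) (hS : ∀ X ∈ S, X + ((1 : ℝ) / N) • e 0 ∈ S)
    (hper : ∀ X ∈ S, f (X + ((1 : ℝ) / N) • e 0) = f X) :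
    ∀ X ∈ S, f (X + e 0) = f X := by
  intro X hX
  -- iterate the `1/N`-translation `N` times
  have key : ∀ k : ℕ, ∀ Y ∈ S, f (Y + ((k : ℝ) / N) • e 0) = f Y ∧ Y + ((k : ℝ) / N) • e 0 ∈ S := by
    intro k
    induction k with
    | zero => intro Y hY; simp [hY]
    | succ k ih =>
      intro Y hY
      obtain ⟨h1, h2⟩ := ih Y hY
      have h3 := hper _ h2
      have h4 := hS _ h2
      have hsplit : Y + (((k + 1 : ℕ) : ℝ) / N) • e 0
          = (Y + ((k : ℝ) / N) • e 0) + ((1 : ℝ) / N) • e 0 := by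
        rw [add_assoc, ← add_smul]
        congr 1
        push_cast
        ring_nf
      refine ⟨?_, ?_⟩
      · rw [hsplit, h3, h1]
      · rw [hsplit]; exact h4
  have hNR : (N : ℝ) ≠ 0 := by exact_mod_cast hN.ne'
  have := (key N X hX).1
  simpa [div_self hNR] using this

/-- (f) Energy-flux bookkeeping used by both cards: for a witness, the energy flux through the
unit square at height `1` equals the flux per unit area through every dyadic height (steady
Euler ⇒ `div (V H) = 0`; band periodicity kills lateral terms; dilation rescales). Statement of
the `z = 2` instance. -/
def FluxPerAreaDyadic : Prop :=
  ∀ (V : E3 → E3) (Q : E3 → ℝ) (C F : ℝ), HSHBody V Q C F →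
    let pt2 : ℝ × ℝ → E3 := fun q => !₂[q.1, q.2, (2 : ℝ)]
    (∫ q in Set.Icc (0 : ℝ) 2 ×ˢ Set.Icc (0 : ℝ) 2,
        (V (pt2 q)) 2 * (‖V (pt2 q)‖ ^ 2 / 2 + Q (pt2 q))) = 4 * F

end Summit.AnomalousDissipation.AnomalousDissipation.Cruxes.HalfSpaceHierarchy.Sketch

end
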